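import Mathlib
import HarnessLib
import Summits.ResolutionOfSingularities.ResolutionOfSingularities.Theorems.WildQuotientsWildQuotientResolutionEigenlineQuadraticTransform

/-!
# Restricting a group of field automorphisms to a stable local subring (Kollár–Szabó going down, glue (K2-glue))
# (crux `WildQuotients.WildQuotientResolution`, stub `stub_phaseZeroHighDim`)

Crux stmt-ResolutionOfSingularities-15640 (`WildQuotientResolution`), registered stub `stub_phaseZeroHighDim`.
✓`EigenlineChart.exists_equivariant_quadraticTransform` (p828025) outputs a subring `R₁ ⊆ K` stable under a family
`σ_h : K ≃+* K`; the next eigenline step (✓`AbelianEigenline.exists_stable_tangentHyperplane`, p826834) wants the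
action as a homomorphism `H →* (R₁ ≃+* R₁)`. This file is that bookkeeping: a group homomorphism
`σ : H →* (K ≃+* K)` whose members map a subring `R` into itself restricts to `τ : H →* (R ≃+* R)` with
`τ h z = σ h z` in `K`; residue-triviality in the «zero or inverse outside» form of p828025 becomes
`τ h z - z ∈ maximalIdeal R`.

[OURS · crux stmt-ResolutionOfSingularities-15640 · helper toward `stub_phaseZeroHighDim` (glue (K2-glue) of memo
PHASE0-KS-EIGENLINE-K2); folklore, counted 0; AI-level work, weaker than expert review.] [folklore]
-/

-- single-problem summit: the doubled namespace component `ResolutionOfSingularities` is forced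
set_option linter.dupNamespace false

noncomputable section

namespace Summit.ResolutionOfSingularities.ResolutionOfSingularities.Theorems.WildQuotientResolution.EigenlineChart

open IsLocalRing Literature.AlgebraicGeometry.Resolution

universe u

variable {K : Type u} [Field K]

/-- **Restriction of a group of automorphisms of `K` to a stable subring.** If every `σ_h` maps `R` into itself
(hence onto: `σ_{h⁻¹}` does too), the action restricts to `τ : H →* (R ≃+* R)` with `τ h z = σ h z`. [folklore] -/
theorem exists_restrict_ringAut (R : Subring K) {H : Type*} [Group H] (σ : H →* (K ≃+* K))
    (hσ : ∀ h : H, ∀ z ∈ R, σ h z ∈ R) :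
    ∃ τ : H →* (R ≃+* R), ∀ (h : H) (z : R), ((τ h z : R) : K) = σ h z := by
  have hinv : ∀ (h : H) (z : K), σ h⁻¹ (σ h z) = z := fun h z => by
    rw [← RingAut.mul_apply, ← map_mul, inv_mul_cancel, map_one, RingAut.one_apply]
  have hinv' : ∀ (h : H) (z : K), σ h (σ h⁻¹ z) = z := fun h z => by
    have h1 := hinv h⁻¹ z
    rwa [inv_inv] at h1
  let e : H → (R ≃+* R) := fun h =>
    { toFun := fun z => ⟨σ h z, hσ h z z.2⟩
      invFun := fun z => ⟨σ h⁻¹ z, hσ h⁻¹ z z.2⟩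
      left_inv := fun z => Subtype.ext (hinv h z)
      right_inv := fun z => Subtype.ext (hinv' h z)
      map_mul' := fun a b => Subtype.ext (by simp)
      map_add' := fun a b => Subtype.ext (by simp) }
  refine ⟨{ toFun := e, map_one' := ?_, map_mul' := fun g h => ?_ }, fun h z => rfl⟩
  · ext z
    change σ 1 (z : K) = z
    rw [map_one, RingAut.one_apply]
  · ext z
    change σ (g * h) (z : K) = σ g (σ h z)
    rw [map_mul, RingAut.mul_apply]

/-- **Residue-triviality transfers to the restricted action**: in a local subring `R ⊆ K`, «`σ h z - z` is zero or
has its inverse outside `R`» (the output form of ✓`exists_equivariant_quadraticTransform`) says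
`τ h z - z ∈ maximalIdeal R` for the restricted action `τ`. [folklore] -/
theorem restrict_sub_mem_maximalIdeal (R : Subring K) [IsLocalRing R] {H : Type*} [Group H]
    (σ : H →* (K ≃+* K)) (τ : H →* (R ≃+* R)) (hτ : ∀ (h : H) (z : R), ((τ h z : R) : K) = σ h z)
    (hres : ∀ h : H, ∀ z ∈ R, σ h z - z = 0 ∨ (σ h z - z)⁻¹ ∉ R) (h : H) (z : R) :
    τ h z - z ∈ maximalIdeal R := by
  rw [mem_maximalIdeal_iff_inv_not_mem]
  have e : ((τ h z - z : R) : K) = σ h z - z := by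
    rw [AddSubgroupClass.coe_sub, hτ]
  rw [e]
  exact hres h z z.2

end Summit.ResolutionOfSingularities.ResolutionOfSingularities.Theorems.WildQuotientResolution.EigenlineChart

end
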